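import Summits.BirchSwinnertonDyer.Rank1Residual.X11b.RouteR1HalvesAllFramesRecord
import Summits.BirchSwinnertonDyer.Rank1Residual.X11b.RouteR1IMCEqIntCoreFrame
import Summits.BirchSwinnertonDyer.Rank1Residual.GaloisImage.EPCTateFormula
import HarnessLib

/-!
# X11b, route R1 at `p ≥ 5` — the records of record with the cited input `hEP` DISCHARGED
# (Tate's local Euler–Poincaré characteristic formula is now a kernel theorem,
# `GaloisImage.EPCTate.localEulerPoincareCharacteristic`): 4 CITED facts instead of 5

HONEST FRAMING (cell `b2b-bsdres`, run/shared/lean/b2b/bsd-rank1-residual/, verbatim in every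
file): the goal of the cell is to DELETE the COMBINATION-SHAPED residual classes of the
Birch–Swinnerton-Dyer formula for ALL analytic-rank `≤ 1` elliptic curves over `ℚ` — "full BSD
formula for every rank `≤ 1` curve in class `C`" assembled STRICTLY from published theorems — so
that the rank-`≤ 1` remainder becomes exactly the CONSTRUCTION-SHAPED classes, which are TYPED
(missing-input `Prop`s), NOT attempted. This is not "finishing BSD". Sub-cell
`b2b-bsdres-multr1-p1` (X11b, route R1, gen 38); a RESEARCH ROUTE; no claim beyond the stated
class; X11b stays CONSTRUCTION-SHAPED; nothing here changes a label; THEOREMS ONLY, all CONDITIONAL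
on ONE OPEN shape (H3∀′ / H3∃⁻ / H3∃♭⁻ / H3∃♭); no definition, no named fact, no `sorry`.

## What this file does

Every record of route R1 (`RouteR1HalvesAllFramesRecord.lean`, `RouteR1IMCEqCoreFrame.lean`,
`RouteR1IMCEqIntCoreFrame.lean`, `RouteR1IntFrame.lean`, `RouteR1OpenInputTight.lean`) carries the
binder
`hEP : ∀ K [NumberField K] (v : HeightOneSpectrum (𝓞 K)), localEulerPoincareCharacteristic (K_v)`
— Tate's local Euler–Poincaré characteristic formula (Milne, *ADT* I Thm. 2.8), one of the FIVE
CITED cohomological inputs `hPT hPT2 hEP hcd hBr` of the anticyclotomic control theorem. Team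
n1011's row T-EPC has PROVED that fact in the kernel for every non-archimedean local field of
characteristic `0` (`GaloisImage.EPCTate.localEulerPoincareCharacteristic`,
`GaloisImage/EPCTateFormula.lean`). This file instantiates it at the completions `K_v` and re-issues
the records WITHOUT the `hEP` binder; every statement below is the statement of record with `hEP`
deleted and NOTHING ELSE changed, and every proof is the record of record applied to
`R1.localEulerPoincareCharacteristic_adicCompletion`:

* §1 `R1.localEulerPoincareCharacteristic_adicCompletion` — the former binder `hEP`, as a theorem.
* §2 `R1.openInputOnTreeAt_iff_bsdp_finalEP` — gen 19's TIGHTNESS `R1OpenInputOnTreeAt W p ↔ BSDp W p`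
  on `R1Population ∩ {r_an = 1}` from 7 PUBLISHED + 4 CITED facts (`hPT hPT2 hcd hBr`).
* §3 the four records, `hEP`-free: **`R1.bsdp_of_imcEqIntFrame_recordEP`** (all of
  `R1Population ∩ {r_an = 1}`, open input H3∃♭), **`R1.bsdp_of_thm32_of_imcEqCoreFrame_recordEP`**,
  **`R1.bsdp_of_thm32_of_imcEqIntCoreFrame_recordEP`**, **`R1.bsdp_of_thm32_of_imcEqAllFrames_recordEP`**
  (SEMISTABLE pairs, open input H3∃⁻ / H3∃♭⁻ / H3∀′ resp., `h32` = Cas18 Thms. 3.1–3.2 among the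
  published inputs); and `R1.openInputOnTreeAt_of_imcEqIntFrameEP` (the open input from H3∃♭).

After this file route R1's input list at `p ≥ 5` reads: 8 PUBLISHED named facts (7 on the `IntFrame`
record) + FOUR CITED standard facts (`hPT` Poitou–Tate for Selmer structures, `hPT2` Poitou–Tate for
`Ш`, `hcd` `cd_p(G_K) ≤ 2`, `hBr` Brink 2007) + ONE OPEN input (erratum Thm. 1.1 for Castella's
`L_p(f)`, ⇐ [FW21, Thm. 4.41], PREPRINT). CONDITIONAL; deletes nothing; X11b stays
CONSTRUCTION-SHAPED; no label change; the records of record are untouched (this is a new file).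

References: [Castella2018] Thms. 2.3, 3.1, 3.2, §5 (arXiv:1704.06608 pp. 5, 9, 12);
[Castella2018Erratum] Thm. 1.1, Thm. A′ (p. 1); [FouquetWan2021] Thm. 4.41;
[MilneADT2006] I §2 Thm. 2.8 (p. 31); [SerreGaloisCohomology1997] II §5.7 Thm. 5.
-/

noncomputable section

open scoped Classical

open WeierstrassCurve NumberField IsDedekindDomain Field PowerSeries
open Literature.NumberTheory.EllipticCurves Literature.NumberTheory.EllipticCurves.GreenbergSelmer
open Literature.NumberTheory.EllipticCurves.ModularForms
open Literature.NumberTheory.EllipticCurves.Rank1Residual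
open Literature.NumberTheory.EllipticCurves.Rank1Residual.Typed
open Literature.NumberTheory.EllipticCurves.Castella2018
open Literature.NumberTheory.GaloisRepresentations
open Literature.NumberTheory.GaloisCohomology
open Summit.BirchSwinnertonDyer.Rank1Residual.X11b.AcSelmer
open Summit.BirchSwinnertonDyer.Rank1Residual.X11b.Halves

namespace Summit.BirchSwinnertonDyer.Rank1Residual.X11b

/-! ### §1 The cited input `hEP`, discharged -/

/-- **Tate's local Euler–Poincaré characteristic formula at every completion `K_v` of every number
field** — exactly the binder `hEP` of route R1's records, now a theorem: the kernel theorem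
`GaloisImage.EPCTate.localEulerPoincareCharacteristic` (team n1011, row T-EPC; every non-archimedean
local field of characteristic `0`) instantiated at `K_v = v.adicCompletion K`.
[cite: MilneADT2006, I §2 Thm 2.8 (p. 31)] [cite: SerreGaloisCohomology1997, II §5.7 Thm. 5] -/
theorem R1.localEulerPoincareCharacteristic_adicCompletion :
    ∀ (K : Type) [Field K] [NumberField K] (v : HeightOneSpectrum (𝓞 K)),
      localEulerPoincareCharacteristic (v.adicCompletion K) := by
  intro K _ _ v
  haveI : CharZero (v.adicCompletion K) :=
    charZero_of_injective_algebraMap (algebraMap K _).injective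
  exact GaloisImage.EPCTate.localEulerPoincareCharacteristic (v.adicCompletion K)

/-! ### §2 Gen 19's tightness, `hEP`-free -/

section Record

variable {W : WeierstrassCurve ℚ} [W.IsElliptic] [W.IsGloballyMinimal] {p : ℕ} [Fact p.Prime]

/-- **TIGHTNESS of route R1's open input, `hEP` discharged**: on `R1Population ∩ {r_an = 1}`, from the
SEVEN PUBLISHED named facts `hGZ` (Gross–Zagier 1986 I.7.3), `hGZK`, `hSk` (Skinner 2016 Thm. C),
`hmod`, `hCST` (Cai–Shu–Tian 2014 Thm. 1.1), `hFH` (Friedberg–Hoffstein 1995 Thm. B), `hMaz`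
(Mazur 1978 Cor. 4.1) and the FOUR CITED cohomological facts `hPT hPT2 hcd hBr`, the open input at `𝟙`
holds IFF `BSD(E,p)`. This is `R1.openInputOnTreeAt_iff_bsdp_final` with `hEP` supplied by
`R1.localEulerPoincareCharacteristic_adicCompletion`; nothing else changed.
[cite: Castella2018, §5 (arXiv:1704.06608 p. 12)] [cite: Castella2018Erratum, Thm. 1.1 (p. 1)] -/
theorem R1.openInputOnTreeAt_iff_bsdp_finalEP
    (hGZ : GrossZagier1986_thm_I_7_3) (hGZK : rank_eq_analyticRank_of_analyticRank_le_one)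
    (hSk : Skinner2016.thmC_padicValRat_bsd_rank_zero) (hmod : exists_isNewformOf)
    (hCST : CaiShuTian2014.thm11_trivialChar)
    (hFH : friedbergHoffstein_exists_twist_ne_zero_ramifiedAt)
    (hMaz : mazur_not_dvd_maninConstant_of_odd)
    (hPT : ∀ (K : Type) [Field K] [NumberField K], poitouTate_selmerStructure_duality K)
    (hPT2 : ∀ (K : Type) [Field K] [NumberField K], poitouTate_sha_tateDual K)
    (hcd : fieldCdLE_two_of_numberField)
    (hBr : ∀ (K : Type) [Field K] [NumberField K] (p : ℕ) [Fact p.Prime],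
      ZpExtension.decomp_not_le_kerSubgroup_of_isAnticyclotomic K p)
    (hW : R1Population W p) (hr : W.analyticRank = 1) :
    R1OpenInputOnTreeAt W p ↔ BSDp W p :=
  R1.openInputOnTreeAt_iff_bsdp_final (W := W) (p := p) hGZ hGZK hSk hmod hCST hFH hMaz hPT hPT2
    R1.localEulerPoincareCharacteristic_adicCompletion hcd hBr hW hr

/-! ### §3 The records, `hEP`-free -/

/-- **Route R1's open input from H3∃♭, `hEP` discharged** — `R1.openInputOnTreeAt_of_imcEqIntFrame'`
(`hmod`, `hGZK`, the cited control facts, H3∃♭ ⟹ `R1OpenInputOnTreeAt W p`; no embedding datum) with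
`hEP` supplied by `R1.localEulerPoincareCharacteristic_adicCompletion`. CONDITIONAL on H3∃♭ (open).
[cite: Castella2018, Thms. 2.3, 3.1, 3.2 and §5 (arXiv:1704.06608 pp. 5, 9, 12)]
[cite: Castella2018Erratum, Thm. 1.1 (p. 1)] -/
theorem R1.openInputOnTreeAt_of_imcEqIntFrameEP
    (hmod : exists_isNewformOf) (hGZK : rank_eq_analyticRank_of_analyticRank_le_one)
    (hPT : ∀ (K : Type) [Field K] [NumberField K], poitouTate_selmerStructure_duality K)
    (hPT2 : ∀ (K : Type) [Field K] [NumberField K], poitouTate_sha_tateDual K)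
    (hcd : fieldCdLE_two_of_numberField)
    (hBr : ∀ (K : Type) [Field K] [NumberField K] (p : ℕ) [Fact p.Prime],
      ZpExtension.decomp_not_le_kerSubgroup_of_isAnticyclotomic K p)
    (h3 : R1.IMCEqIntFrameOnTree W p) : R1OpenInputOnTreeAt W p :=
  R1.openInputOnTreeAt_of_imcEqIntFrame' hmod hGZK hPT hPT2
    R1.localEulerPoincareCharacteristic_adicCompletion hcd hBr h3

/-- **Route R1 — THE RECORD IN `R₀`-FREE FRAME FORM, `hEP` discharged: all of
`R1Population ∩ {r_an = 1}`, `p ≥ 5`, 7 PUBLISHED + 4 CITED + ONE OPEN input.** For every globally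
minimal elliptic `W/ℚ` and prime `p` on `R1Population` with `ord_{s=1} L(E,s) = 1`: `BSD(E,p)`, from the
SEVEN PUBLISHED named facts `hGZ` (Gross–Zagier 1986 I.7.3), `hGZK` (Gross–Zagier–Kolyvagin), `hSk`
(Skinner 2016 Thm. C), `hmod` (modularity), `hCST` (Cai–Shu–Tian 2014 Thm. 1.1), `hFH`
(Friedberg–Hoffstein 1995 Thm. B), `hMaz` (Mazur 1978 Cor. 4.1), the FOUR CITED cohomological facts
`hPT hPT2 hcd hBr` (Poitou–Tate twice, `cd_p(G_K) ≤ 2`, Brink 2007), and the ONE OPEN input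
`h3 : R1.IMCEqIntFrameOnTree W p` (per datum: a frame `Q ∈ 𝓞_{ℂ_p}⟦T⟧` with Cas18 Thm. 3.1's
interpolation property, Thm. 3.2's value at `𝟙` and erratum Thm. 1.1's main-conjecture equality;
HONEST CONTENT as in `R1.bsdp_of_imcEqIntFrame_record`: on SEMISTABLE pairs what is open is erratum
Thm. 1.1 for Castella's `L_p(f)` (⇐ [FW21, Thm. 4.41], PREPRINT); on NON-semistable pairs all three
conjuncts are unrefereed ([Castella 2024, Thm. 3.1, §2.3], PREPRINT)). This is
`R1.bsdp_of_imcEqIntFrame_record` with `hEP` (Tate's local Euler–Poincaré formula, now the kernel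
theorem `GaloisImage.EPCTate.localEulerPoincareCharacteristic`) supplied; nothing else changed.
CONDITIONAL; deletes nothing; X11b stays CONSTRUCTION-SHAPED; no label change.
[cite: Castella2018, §5 (arXiv:1704.06608 p. 12)] [cite: Castella2018Erratum, Thm. 1.1, Thm. A′ (p. 1)] -/
theorem R1.bsdp_of_imcEqIntFrame_recordEP
    (hGZ : GrossZagier1986_thm_I_7_3) (hGZK : rank_eq_analyticRank_of_analyticRank_le_one)
    (hSk : Skinner2016.thmC_padicValRat_bsd_rank_zero) (hmod : exists_isNewformOf)
    (hCST : CaiShuTian2014.thm11_trivialChar)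
    (hFH : friedbergHoffstein_exists_twist_ne_zero_ramifiedAt)
    (hMaz : mazur_not_dvd_maninConstant_of_odd)
    (hPT : ∀ (K : Type) [Field K] [NumberField K], poitouTate_selmerStructure_duality K)
    (hPT2 : ∀ (K : Type) [Field K] [NumberField K], poitouTate_sha_tateDual K)
    (hcd : fieldCdLE_two_of_numberField)
    (hBr : ∀ (K : Type) [Field K] [NumberField K] (p : ℕ) [Fact p.Prime],
      ZpExtension.decomp_not_le_kerSubgroup_of_isAnticyclotomic K p)
    (h3 : R1.IMCEqIntFrameOnTree W p) (hW : R1Population W p) (hr : W.analyticRank = 1) :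
    BSDp W p :=
  R1.bsdp_of_imcEqIntFrame_record hGZ hGZK hSk hmod hCST hFH hMaz hPT hPT2
    R1.localEulerPoincareCharacteristic_adicCompletion hcd hBr h3 hW hr

/-- **Route R1 — THE RECORD ON SEMISTABLE PAIRS FROM H3∃⁻, `hEP` discharged: `p ≥ 5`, 8 PUBLISHED +
4 CITED + ONE OPEN input carrying NO value conjunct.** For every SEMISTABLE globally minimal elliptic
`W/ℚ` and prime `p` on `R1Population` with `ord_{s=1} L(E,s) = 1`: `BSD(E,p)`, from the EIGHT
PUBLISHED named facts `hGZ`, `hGZK`, `hSk`, `hmod`, `hCST`, `hFH`, `hMaz`, `h32` (Cas18 Thms.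
3.1–3.2), the FOUR CITED cohomological facts `hPT hPT2 hcd hBr`, and the ONE OPEN input
`h3 : R1.IMCEqCoreFrameOnTree W p` (per datum a frame `L ∈ R₀⟦T⟧` with the interpolation property and
erratum Thm. 1.1's main-conjecture equality, ⇐ [FW21, Thm. 4.41], PREPRINT). This is
`R1.bsdp_of_thm32_of_imcEqCoreFrame_record` with `hEP` supplied by
`R1.localEulerPoincareCharacteristic_adicCompletion`; nothing else changed. CONDITIONAL; deletes
nothing; X11b stays CONSTRUCTION-SHAPED; no label change.
[cite: Castella2018, §5 (arXiv:1704.06608 p. 12)] [cite: Castella2018Erratum, Thm. 1.1, Thm. A′ (p. 1)] -/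
theorem R1.bsdp_of_thm32_of_imcEqCoreFrame_recordEP
    (hGZ : GrossZagier1986_thm_I_7_3) (hGZK : rank_eq_analyticRank_of_analyticRank_le_one)
    (hSk : Skinner2016.thmC_padicValRat_bsd_rank_zero) (hmod : exists_isNewformOf)
    (hCST : CaiShuTian2014.thm11_trivialChar)
    (hFH : friedbergHoffstein_exists_twist_ne_zero_ramifiedAt)
    (hMaz : mazur_not_dvd_maninConstant_of_odd) (h32 : thm32_exists_isBDPLFunction_valueAtOne)
    (hPT : ∀ (K : Type) [Field K] [NumberField K], poitouTate_selmerStructure_duality K)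
    (hPT2 : ∀ (K : Type) [Field K] [NumberField K], poitouTate_sha_tateDual K)
    (hcd : fieldCdLE_two_of_numberField)
    (hBr : ∀ (K : Type) [Field K] [NumberField K] (p : ℕ) [Fact p.Prime],
      ZpExtension.decomp_not_le_kerSubgroup_of_isAnticyclotomic K p)
    (hss : Semistable W) (h3 : R1.IMCEqCoreFrameOnTree W p) (hW : R1Population W p)
    (hr : W.analyticRank = 1) : BSDp W p :=
  R1.bsdp_of_thm32_of_imcEqCoreFrame_record hGZ hGZK hSk hmod hCST hFH hMaz h32 hPT hPT2
    R1.localEulerPoincareCharacteristic_adicCompletion hcd hBr hss h3 hW hr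

/-- **Route R1 — THE RECORD ON SEMISTABLE PAIRS FROM H3∃♭⁻, `hEP` discharged: `p ≥ 5`, 8 PUBLISHED +
4 CITED + ONE OPEN input with NO value conjunct and NO rationality clause.** For every SEMISTABLE
globally minimal elliptic `W/ℚ` and prime `p` on `R1Population` with `ord_{s=1} L(E,s) = 1`:
`BSD(E,p)`, from `hGZ`, `hGZK`, `hSk`, `hmod`, `hCST`, `hFH`, `hMaz`, `h32` (Cas18 Thms. 3.1–3.2),
the FOUR CITED cohomological facts `hPT hPT2 hcd hBr`, and the ONE OPEN input
`h3 : R1.IMCEqIntCoreFrameOnTree W p` (per datum a `Q ∈ 𝓞_{ℂ_p}⟦T⟧` with Castella's interpolation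
property and erratum Thm. 1.1's equality, ⇐ [FW21, Thm. 4.41], PREPRINT). This is
`R1.bsdp_of_thm32_of_imcEqIntCoreFrame_record` with `hEP` supplied by
`R1.localEulerPoincareCharacteristic_adicCompletion`; nothing else changed. CONDITIONAL; deletes
nothing; X11b stays CONSTRUCTION-SHAPED; no label change.
[cite: Castella2018, §5 (arXiv:1704.06608 p. 12)] [cite: Castella2018Erratum, Thm. 1.1, Thm. A′ (p. 1)] -/
theorem R1.bsdp_of_thm32_of_imcEqIntCoreFrame_recordEP
    (hGZ : GrossZagier1986_thm_I_7_3) (hGZK : rank_eq_analyticRank_of_analyticRank_le_one)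
    (hSk : Skinner2016.thmC_padicValRat_bsd_rank_zero) (hmod : exists_isNewformOf)
    (hCST : CaiShuTian2014.thm11_trivialChar)
    (hFH : friedbergHoffstein_exists_twist_ne_zero_ramifiedAt)
    (hMaz : mazur_not_dvd_maninConstant_of_odd) (h32 : thm32_exists_isBDPLFunction_valueAtOne)
    (hPT : ∀ (K : Type) [Field K] [NumberField K], poitouTate_selmerStructure_duality K)
    (hPT2 : ∀ (K : Type) [Field K] [NumberField K], poitouTate_sha_tateDual K)
    (hcd : fieldCdLE_two_of_numberField)
    (hBr : ∀ (K : Type) [Field K] [NumberField K] (p : ℕ) [Fact p.Prime],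
      ZpExtension.decomp_not_le_kerSubgroup_of_isAnticyclotomic K p)
    (hss : Semistable W) (h3 : R1.IMCEqIntCoreFrameOnTree W p) (hW : R1Population W p)
    (hr : W.analyticRank = 1) : BSDp W p :=
  R1.bsdp_of_thm32_of_imcEqIntCoreFrame_record hGZ hGZK hSk hmod hCST hFH hMaz h32 hPT hPT2
    R1.localEulerPoincareCharacteristic_adicCompletion hcd hBr hss h3 hW hr

/-- **Route R1 — THE GEN-21 RECORD REPAIRED (H3∀′ with `Ω_K ≠ 0`), `hEP` discharged: SEMISTABLE pairs,
`p ≥ 5`, 8 PUBLISHED + 4 CITED + ONE OPEN ∀-frame input.** For every SEMISTABLE globally minimal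
elliptic `W/ℚ` and prime `p` on `R1Population` with `ord_{s=1} L(E,s) = 1`: `BSD(E,p)`, from `hGZ`,
`hGZK`, `hSk`, `hmod`, `hCST`, `hFH`, `hMaz`, `h32` (Cas18 Thms. 3.1–3.2), the FOUR CITED
cohomological facts `hPT hPT2 hcd hBr`, and the ONE OPEN input `h3 : R1.IMCEqAllFramesOnTree W p`
(erratum Thm. 1.1's equality at every GENUINE frame, `Ω_K ≠ 0`; ⇐ [FW21, Thm. 4.41], PREPRINT).
This is `R1.bsdp_of_thm32_of_imcEqAllFrames_record` with `hEP` supplied by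
`R1.localEulerPoincareCharacteristic_adicCompletion`; nothing else changed. CONDITIONAL; deletes
nothing; X11b stays CONSTRUCTION-SHAPED; no label change.
[cite: Castella2018, §5 (arXiv:1704.06608 p. 12)] [cite: Castella2018Erratum, Thm. 1.1, Thm. A′ (p. 1)] -/
theorem R1.bsdp_of_thm32_of_imcEqAllFrames_recordEP
    (hGZ : GrossZagier1986_thm_I_7_3) (hGZK : rank_eq_analyticRank_of_analyticRank_le_one)
    (hSk : Skinner2016.thmC_padicValRat_bsd_rank_zero) (hmod : exists_isNewformOf)
    (hCST : CaiShuTian2014.thm11_trivialChar)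
    (hFH : friedbergHoffstein_exists_twist_ne_zero_ramifiedAt)
    (hMaz : mazur_not_dvd_maninConstant_of_odd) (h32 : thm32_exists_isBDPLFunction_valueAtOne)
    (hPT : ∀ (K : Type) [Field K] [NumberField K], poitouTate_selmerStructure_duality K)
    (hPT2 : ∀ (K : Type) [Field K] [NumberField K], poitouTate_sha_tateDual K)
    (hcd : fieldCdLE_two_of_numberField)
    (hBr : ∀ (K : Type) [Field K] [NumberField K] (p : ℕ) [Fact p.Prime],
      ZpExtension.decomp_not_le_kerSubgroup_of_isAnticyclotomic K p)
    (hss : Semistable W) (h3 : R1.IMCEqAllFramesOnTree W p) (hW : R1Population W p)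
    (hr : W.analyticRank = 1) : BSDp W p :=
  R1.bsdp_of_thm32_of_imcEqAllFrames_record hGZ hGZK hSk hmod hCST hFH hMaz h32 hPT hPT2
    R1.localEulerPoincareCharacteristic_adicCompletion hcd hBr hss h3 hW hr

end Record

end Summit.BirchSwinnertonDyer.Rank1Residual.X11b

end
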